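import Summits.QuantumFields.YangMills.Theorems.BalabanUVNodesN16AtRecord
import Summits.QuantumFields.YangMills.Theorems.BalabanUVNodesN16Thm4Print
import HarnessLib

/-!
# Route «BalabanUVNodes», cluster K4 «SpineRates» — node N16 = NE3 «AT THE RECORD», THE SLOT RESTATED OVER PRINT's [B8] THEOREM 4 (ALL-TORUS GEOMETRY,
# CONCRETE CONCLUSION SLOT): `S_N16 RRec` for every rate-record predicate pinning NE3's carriers inside THE END's regime at which N05's node holds in
# the form (T4ᵀ_print) of `BalabanUVNodesN16Thm4Print` and N07's interface holds — the instancer's clause for N16 with print's Theorem 4 as the ONLY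
# N05-side hypothesis (no `PairLandauGaugeB8Avg`, no (OUT), no dictionary binder)

Cell `pub-ymgap`, seat `pub-ymgap-dag-n16-a` (KNIT-BY-NAME, HUMAN RULING D-0062; chair R424 venue), generation 4, file 14.  `bears_on: R4∕N16 · K4 stub S_N16`.  Filed
`--supports stmt-QuantumFields-19182`.  Companion of file 5 `BalabanUVNodesN16AtRecord` ((W2) shape), file 8 `…AtRecordThm4Output` (the slot over (OUT)) and
file 13 `BalabanUVNodesN16Thm4Print` (`n16_of_thm4TorusAt_print`).

CONTENT (0 `def`, 0 `sorry`; by name): `n16At_of_pinned_thm4TorusAt_print` — THE SLOT IN (T4ᵀ_print) FORM: there are `r > 0` and `Cof : ℝ → ℝ≥0` (functions of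
`(L, Nper, N)`; THE END's, independent of Theorem 4's constants) such that every bundle `c : NE3Carriers N` with `c.L = L`, `c.Nper = Nper`, `0 < c.g`, `0 < c.ε ≤ r`,
`0 ≤ c.Λ₁ ≤ r`, `0 ≤ c.b ≤ c.ε∕2`, `Cof c.g ≤ c.C`, at which — for SOME Theorem-4 constants `(c₁, B, B_h)`, leaf letters `(b′, c′)` on the two ε-free lines, an
averaging letter `α` in the displayed window with `c.ε < α`, a (3.35) schedule `(Mc, 𝒬, C₃₃₅)`, and the four k-free letter lines placing `177Bα`, `177B_hα` below
`c.Λ₁`, `c.Λ₂'` — [Balaban1985RegularSpaces] THEOREM 4 HOLDS IN THE ALL-TORUS GEOMETRY at every level `k ≥ 1` in the form `Thm4TorusAt c.L k (c.Nper·c.Lᵏ) (c.Lᵏ)⁻¹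
c₁ unitaryUnits (Reg335Zd … (𝒬 k) C₃₃₅) (Restr129 c.L k (torusLam k)) Concl_print(B, B_h)` and `LeafH3sup 4 c.L c.Nper c.ε b′ c′ c.dom` holds, satisfies `N16At c`;
**`s_N16_of_pinned_thm4TorusAt_print`** — `S_N16 RRec` for every `RRec` whose bundles carry that slot.

HONEST FRAMING.  Bookkeeping by name; (T4ᵀ_print) = [Balaban1985RegularSpaces] Thm 4 + Prop 3 (torus case p. 77) at curved backgrounds — node N05's theorem,
NOT proved anywhere in the tree; (H3ˢᵘᵖ) = N07's [Balaban1985Variational] Thm 1 (8)+(10) TYPE; no `RRec` home exists ⇒ `S_N16` NOT proved for the record;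
**N16 ∕ NE3 is NOT discharged**; count-neutral; one finite four-torus at fixed ε — NOT ℝ⁴, NOT infinite volume, NOT OS, NOT a mass gap, NOT Clay.
-/

set_option autoImplicit false

open scoped BigOperators Matrix Matrix.Norms.L2Operator
open NormedSpace

namespace Summit.QuantumFields.YangMills.BalabanUVNodes.N16AtRecord

open Literature.MathematicalPhysics.QuantumFieldTheory.Balaban1983to89
open Literature.MathematicalPhysics.QuantumFieldTheory.Balaban1983to89.T4Continuum (T4Family ULoop)
open B7Prop1Explicit B7Prop2Explicit
open T4AveragingDeficitWall (Ad)
open B7Eq92Concrete (mgauge)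
open B8Ineq132 (covDerivFwd)
open B8Eq184Proof (cfgExp)
open B8Eq119TwistedAxial (Restr129)
open B8Eq133Hypotheses (Reg335Zd)
open B8Eq138LandauZd (covLap IsLandau138)
open B8Thm4TorusAt (torusLam Thm4TorusAt)
open Summit.QuantumFields.BalabanUV.T4Continuum
open BlockAverageCurrent (curConst)
open NE3EnergyWeightedCovShape (NE3EnergyRateWCov)
open NE3RightInverseSupLetters (frameC)
open NE3.LeafIndexSockets (LeafH3sup)
open YMDAG.UVSplit (Datum NE3Carriers RateCarriers RateRecordPred N16At S_N16)
open Summit.QuantumFields.YangMills.BalabanUVNodes.N16 (n16_of_thm4TorusAt_print)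

noncomputable section

variable {N : ℕ} [NeZero N]

/-- **THE SLOT IN (T4ᵀ_print) FORM — `N16At` AT EVERY BUNDLE PINNED IN THE END's REGIME AT WHICH PRINT's THEOREM 4 (TORUS GEOMETRY, CONCRETE CONCLUSION) AND
N07's INTERFACE HOLD** (block factor `L ≥ 2`, period `Nper ≥ 1`): file 13's `n16_of_thm4TorusAt_print` packaged bundle-wise (`r`, `Cof` by choice — THE END's, before
Theorem 4's constants; constant raised by `NE3EnergyRateWCov.mono`). [folklore] -/
theorem n16At_of_pinned_thm4TorusAt_print {L Nper : ℕ} (hL : 2 ≤ L) (hN : 1 ≤ Nper) :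
    ∃ r : ℝ, 0 < r ∧ ∃ Cof : ℝ → ℝ, (∀ g, 0 < g → 0 ≤ Cof g) ∧
      ∀ c : NE3Carriers N, c.L = L → c.Nper = Nper → 0 < c.g → 0 < c.ε → c.ε ≤ r → 0 ≤ c.Λ₁ → c.Λ₁ ≤ r → 0 ≤ c.b → c.b ≤ c.ε / 2 →
        Cof c.g ≤ c.C →
        (∃ (c₁ B Bh b' c' α Mc C335 : ℝ) (𝒬 : ℕ → Set (Set (Site 4) × ℕ)),
          0 ≤ b' ∧ 0 ≤ c' ∧ 2 ^ 15 * ((4 : ℝ) + 1) ^ 2 * ((4 : ℝ) + 4) ^ 2 * (c.L : ℝ) ^ 2 * b' ≤ 1 ∧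
          23040 * (4 : ℝ) ^ 4 * (frameC 4 c.L + 4) ^ 3 * (c' + curConst 4 c.L * b' ^ 2) ≤ 1 ∧
          0 < α ∧ C0 4 * α ≤ 1 / 3 ∧ 2 * α ≤ c2' 4 c.L ∧ 11 * (4 : ℝ) ^ 2 * α ≤ 1 / 6 ∧ α + 11 * (4 : ℝ) ^ 2 * α ≤ c₁ ∧
          (b' + 226 * (8 * ((4 : ℝ) + 1) * ((4 : ℝ) + 4)) ^ 2 * b' ^ 2) < α ∧ 4 * ((4 : ℝ) - 1) * (c' + curConst 4 c.L * b' ^ 2) < α ∧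
          0 ≤ Mc ∧ (Mc + 1) * (b' + 226 * (8 * ((4 : ℝ) + 1) * ((4 : ℝ) + 4)) ^ 2 * b' ^ 2) ≤ 1 / 2 ∧
          (∀ k, ∀ q ∈ 𝒬 k, q.2 ≤ k ∧ ∃ y : Site 4, ∀ z ∈ q.1, (l1 (z - y) : ℝ) ≤ Mc * (c.L : ℝ) ^ q.2) ∧
          2 * (Mc + 1) * (b' + 226 * (8 * ((4 : ℝ) + 1) * ((4 : ℝ) + 4)) ^ 2 * b' ^ 2) + 2 * Mc * (2 * (c' + curConst 4 c.L * b' ^ 2)) +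
            4 * Mc * (1 + 2 * Mc) * (b' + 226 * (8 * ((4 : ℝ) + 1) * ((4 : ℝ) + 4)) ^ 2 * b' ^ 2) ^ 2 < C335 ∧
          c.ε < α ∧ B * (α + 11 * (4 : ℝ) ^ 2 * α) ≤ c.Λ₁ ∧
          B * (α + 11 * (4 : ℝ) ^ 2 * α) + 2 * (b' + 226 * (8 * ((4 : ℝ) + 1) * ((4 : ℝ) + 4)) ^ 2 * b' ^ 2) * c.Λ₁ ≤ c.Λ₁ ∧
          B * (α + 11 * (4 : ℝ) ^ 2 * α) + 16 * (b' + 226 * (8 * ((4 : ℝ) + 1) * ((4 : ℝ) + 4)) ^ 2 * b' ^ 2) * (B * (α + 11 * (4 : ℝ) ^ 2 * α)) ≤ c.Λ₁ ∧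
          Bh * (α + 11 * (4 : ℝ) ^ 2 * α) + 8 * (b' + 226 * (8 * ((4 : ℝ) + 1) * ((4 : ℝ) + 4)) ^ 2 * b' ^ 2) * (B * (α + 11 * (4 : ℝ) ^ 2 * α)) ≤ c.Λ₂' ∧
          (∀ k, 1 ≤ k → Thm4TorusAt c.L k (((c.Nper * c.L ^ k : ℕ) : ℤ)) (((c.L : ℝ) ^ k)⁻¹) c₁ (unitaryUnits (Matrix (Fin N) (Fin N) ℂ))
            (Reg335Zd (((c.L : ℝ) ^ k)⁻¹) c.L (𝒬 k) C335) (Restr129 c.L k (torusLam k))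
            (fun (α₀ α₁ : ℝ) (U₀ U' : Site 4 → Fin 4 → (Matrix (Fin N) (Fin N) ℂ)ˣ) (u : Site 4 → (Matrix (Fin N) (Fin N) ℂ)ˣ) =>
              ∃ A : Site 4 → Fin 4 → Matrix (Fin N) (Fin N) ℂ,
                (∀ x μ, IsSelfAdjoint (A x μ)) ∧ (∀ (x : Site 4) (κ μ : Fin 4), A (x + (((c.Nper * c.L ^ k : ℕ) : ℤ)) • e κ) μ = A x μ) ∧
                mgauge U₀ u (cfgExp (((c.L : ℝ) ^ k)⁻¹) A) = U' ∧
                (∀ x μ, ‖A x μ‖ ≤ B * (α₀ + α₁)) ∧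
                (∀ (μ : Fin 4) (x : Site 4) (κ : Fin 4), ‖covDerivFwd (((c.L : ℝ) ^ k)⁻¹) U₀ μ (fun z => A z κ) x‖ ≤ B * (α₀ + α₁)) ∧
                IsLandau138 c.L k (((c.L : ℝ) ^ k)⁻¹) Set.univ (torusLam k) U₀ A ∧
                (∀ (μ : Fin 4) (y : Site 4) (κ : Fin 4),
                  ‖Ad (U₀ y μ) (covDerivFwd (((c.L : ℝ) ^ k)⁻¹) U₀ μ (fun z => A z κ) (y + e μ)) - covDerivFwd (((c.L : ℝ) ^ k)⁻¹) U₀ μ (fun z => A z κ) y‖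
                    ≤ Bh * (α₀ + α₁) * (((c.L : ℝ)⁻¹) ^ k) ^ (1 : ℝ)) ∧
                (∀ (x : Site 4) (κ : Fin 4), ‖covLap (((c.L : ℝ) ^ k)⁻¹) U₀ (fun z => A z κ) x‖ ≤ B * (α₀ + α₁)))) ∧
          LeafH3sup 4 c.L c.Nper c.ε b' c' c.dom) →
        N16At c := by
  obtain ⟨r, hr0, hr⟩ := n16_of_thm4TorusAt_print (n := Fin N) hL hN
  choose Cof hCof0 hCof using hr
  refine ⟨r, hr0, fun g => if h : 0 < g then Cof h else 0, fun g hg => by simp only [dif_pos hg]; exact hCof0 hg, ?_⟩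
  rintro ⟨cL, cN, ε, b, g, C, Λ₁, Λ₂', dom⟩ rfl rfl hg hε hεr hs₁ hs₁r hb hbh hC
    ⟨c₁, B, Bh, b', c', α, Mc, C335, 𝒬, hb', hc', hRb, hcF, hα, hA3, hA2, hAs, hAc, hb'α, hc'α, hMc, hMcα, h𝒬, hC335, hεα, hss, hgrad, hℓ, hhol, hT4, h3⟩
  simp only [dif_pos hg] at hC
  exact (hCof hg c₁ B Bh hb' hc' hRb hcF hα hA3 hA2 hAs hAc hb'α hc'α hMc hMcα 𝒬 h𝒬 hC335 hε hεr hεα hs₁ hs₁r hb hbh hss hgrad hℓ hhol hT4 h3).mono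
    hC le_rfl le_rfl

/-- **REFINEMENT-GENERIC CLOSER IN (T4ᵀ_print) FORM — `S_N16 RRec` FOR EVERY RATE-RECORD PREDICATE CARRYING THE SLOT**: if `RRec F D g₀ os R` forces `R.ne3` into THE
END's regime (radius `r`, constant `≥ Cof R.ne3.g`) and, at its letters, print's [Balaban1985RegularSpaces] Theorem 4 in the all-torus geometry with its conclusion in
print's letters (some constants `(c₁, B, B_h)`, leaf letters, averaging letter, (3.35) schedule and letter lines as displayed) and N07's `LeafH3sup`, then `S_N16 RRec`
— the instancer's clause for N16 whose ONLY N05-side hypothesis is Theorem 4 as printed.  Nothing is asserted about the record's `RRec` (none exists). [folklore] -/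
theorem s_N16_of_pinned_thm4TorusAt_print {L Nper : ℕ} (hL : 2 ≤ L) (hN : 1 ≤ Nper) :
    ∃ r : ℝ, 0 < r ∧ ∃ Cof : ℝ → ℝ, (∀ g, 0 < g → 0 ≤ Cof g) ∧ ∀ RRec : RateRecordPred N,
      (∀ (F : T4Family) (D : Datum F N) (g₀ : ℕ → ℝ) (os : List (ULoop F)) (R : RateCarriers N), RRec F D g₀ os R →
        R.ne3.L = L ∧ R.ne3.Nper = Nper ∧ 0 < R.ne3.g ∧ 0 < R.ne3.ε ∧ R.ne3.ε ≤ r ∧ 0 ≤ R.ne3.Λ₁ ∧ R.ne3.Λ₁ ≤ r ∧ 0 ≤ R.ne3.b ∧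
        R.ne3.b ≤ R.ne3.ε / 2 ∧ Cof R.ne3.g ≤ R.ne3.C ∧
        (∃ (c₁ B Bh b' c' α Mc C335 : ℝ) (𝒬 : ℕ → Set (Set (Site 4) × ℕ)),
          0 ≤ b' ∧ 0 ≤ c' ∧ 2 ^ 15 * ((4 : ℝ) + 1) ^ 2 * ((4 : ℝ) + 4) ^ 2 * (R.ne3.L : ℝ) ^ 2 * b' ≤ 1 ∧
          23040 * (4 : ℝ) ^ 4 * (frameC 4 R.ne3.L + 4) ^ 3 * (c' + curConst 4 R.ne3.L * b' ^ 2) ≤ 1 ∧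
          0 < α ∧ C0 4 * α ≤ 1 / 3 ∧ 2 * α ≤ c2' 4 R.ne3.L ∧ 11 * (4 : ℝ) ^ 2 * α ≤ 1 / 6 ∧ α + 11 * (4 : ℝ) ^ 2 * α ≤ c₁ ∧
          (b' + 226 * (8 * ((4 : ℝ) + 1) * ((4 : ℝ) + 4)) ^ 2 * b' ^ 2) < α ∧ 4 * ((4 : ℝ) - 1) * (c' + curConst 4 R.ne3.L * b' ^ 2) < α ∧
          0 ≤ Mc ∧ (Mc + 1) * (b' + 226 * (8 * ((4 : ℝ) + 1) * ((4 : ℝ) + 4)) ^ 2 * b' ^ 2) ≤ 1 / 2 ∧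
          (∀ k, ∀ q ∈ 𝒬 k, q.2 ≤ k ∧ ∃ y : Site 4, ∀ z ∈ q.1, (l1 (z - y) : ℝ) ≤ Mc * (R.ne3.L : ℝ) ^ q.2) ∧
          2 * (Mc + 1) * (b' + 226 * (8 * ((4 : ℝ) + 1) * ((4 : ℝ) + 4)) ^ 2 * b' ^ 2) + 2 * Mc * (2 * (c' + curConst 4 R.ne3.L * b' ^ 2)) +
            4 * Mc * (1 + 2 * Mc) * (b' + 226 * (8 * ((4 : ℝ) + 1) * ((4 : ℝ) + 4)) ^ 2 * b' ^ 2) ^ 2 < C335 ∧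
          R.ne3.ε < α ∧ B * (α + 11 * (4 : ℝ) ^ 2 * α) ≤ R.ne3.Λ₁ ∧
          B * (α + 11 * (4 : ℝ) ^ 2 * α) + 2 * (b' + 226 * (8 * ((4 : ℝ) + 1) * ((4 : ℝ) + 4)) ^ 2 * b' ^ 2) * R.ne3.Λ₁ ≤ R.ne3.Λ₁ ∧
          B * (α + 11 * (4 : ℝ) ^ 2 * α) + 16 * (b' + 226 * (8 * ((4 : ℝ) + 1) * ((4 : ℝ) + 4)) ^ 2 * b' ^ 2) * (B * (α + 11 * (4 : ℝ) ^ 2 * α)) ≤ R.ne3.Λ₁ ∧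
          Bh * (α + 11 * (4 : ℝ) ^ 2 * α) + 8 * (b' + 226 * (8 * ((4 : ℝ) + 1) * ((4 : ℝ) + 4)) ^ 2 * b' ^ 2) * (B * (α + 11 * (4 : ℝ) ^ 2 * α)) ≤ R.ne3.Λ₂' ∧
          (∀ k, 1 ≤ k → Thm4TorusAt R.ne3.L k (((R.ne3.Nper * R.ne3.L ^ k : ℕ) : ℤ)) (((R.ne3.L : ℝ) ^ k)⁻¹) c₁ (unitaryUnits (Matrix (Fin N) (Fin N) ℂ))
            (Reg335Zd (((R.ne3.L : ℝ) ^ k)⁻¹) R.ne3.L (𝒬 k) C335) (Restr129 R.ne3.L k (torusLam k))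
            (fun (α₀ α₁ : ℝ) (U₀ U' : Site 4 → Fin 4 → (Matrix (Fin N) (Fin N) ℂ)ˣ) (u : Site 4 → (Matrix (Fin N) (Fin N) ℂ)ˣ) =>
              ∃ A : Site 4 → Fin 4 → Matrix (Fin N) (Fin N) ℂ,
                (∀ x μ, IsSelfAdjoint (A x μ)) ∧ (∀ (x : Site 4) (κ μ : Fin 4), A (x + (((R.ne3.Nper * R.ne3.L ^ k : ℕ) : ℤ)) • e κ) μ = A x μ) ∧
                mgauge U₀ u (cfgExp (((R.ne3.L : ℝ) ^ k)⁻¹) A) = U' ∧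
                (∀ x μ, ‖A x μ‖ ≤ B * (α₀ + α₁)) ∧
                (∀ (μ : Fin 4) (x : Site 4) (κ : Fin 4), ‖covDerivFwd (((R.ne3.L : ℝ) ^ k)⁻¹) U₀ μ (fun z => A z κ) x‖ ≤ B * (α₀ + α₁)) ∧
                IsLandau138 R.ne3.L k (((R.ne3.L : ℝ) ^ k)⁻¹) Set.univ (torusLam k) U₀ A ∧
                (∀ (μ : Fin 4) (y : Site 4) (κ : Fin 4),
                  ‖Ad (U₀ y μ) (covDerivFwd (((R.ne3.L : ℝ) ^ k)⁻¹) U₀ μ (fun z => A z κ) (y + e μ)) - covDerivFwd (((R.ne3.L : ℝ) ^ k)⁻¹) U₀ μ (fun z => A z κ) y‖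
                    ≤ Bh * (α₀ + α₁) * (((R.ne3.L : ℝ)⁻¹) ^ k) ^ (1 : ℝ)) ∧
                (∀ (x : Site 4) (κ : Fin 4), ‖covLap (((R.ne3.L : ℝ) ^ k)⁻¹) U₀ (fun z => A z κ) x‖ ≤ B * (α₀ + α₁)))) ∧
          LeafH3sup 4 R.ne3.L R.ne3.Nper R.ne3.ε b' c' R.ne3.dom)) →
      S_N16 RRec := by
  obtain ⟨r, hr0, Cof, hCof0, hAt⟩ := n16At_of_pinned_thm4TorusAt_print (N := N) hL hN
  refine ⟨r, hr0, Cof, hCof0, fun RRec hpin F D g₀ os R hR => ?_⟩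
  obtain ⟨h1, h2, h3, h4, h5, h6, h7, h8, h9, h10, hslot⟩ := hpin F D g₀ os R hR
  exact hAt R.ne3 h1 h2 h3 h4 h5 h6 h7 h8 h9 h10 hslot

end

end Summit.QuantumFields.YangMills.BalabanUVNodes.N16AtRecord
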